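import Literature.MathematicalPhysics.QuantumLattice.HubbardTTPrimeGrandCanonicalPressure
import HarnessLib

/-!
# The grand-canonical pressure number on the square torus `(ℤ/Lℤ)²`: the `hubbardTorusTT'` form of the
# Legendre dictionary

Topic `MathematicalPhysics/QuantumLattice` (family `hubbard`); a bridge for `HubbardTTPrimeGrandCanonicalPressure.lean`.
There the grand-canonical pressure `gcPressureTT' β t t' U μ` is the limit of `L⁻² log Re Z_β(H_L − μN)` for the
RECTANGULAR-torus Hamiltonian `H_L = hubbardRectTorusTT' L L t t' U` (sites `Fin L ×ₗ Fin L`). The programme's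
grand-canonical certificates (high-temperature / cluster expansions, `HubbardTorusSingleScalePressure`,
`SectorPartitionFnGrandCanonicalBound`, `HubbardTTPrimeThermalPressureGrandCanonicalCeiling`) are stated on the
SQUARE torus `hubbardTorusTT' L t t' U` (sites `FermionTorus 2 L = (ℤ/Lℤ)²`). The two grand-canonical partition
functions coincide — both are `Σ_{a,b ≤ L²} e^{βμ(a+b)} Z(a,b)` (sector decomposition) and the sector partition
functions agree under the site relabelling `squareToRect` (`partitionFn_spinSector_hubbardTorusTT'_eq_rect`):

* `partitionFn_grandCanonical_hubbardTorusTT'_re_eq_rect` — `Re Z_β(hubbardTorusTT' L − μN) = Re Z_β(hubbardRectTorusTT' L L − μN)`;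
* `tendsto_log_partitionFn_grandCanonical_hubbardTorusTT'_div_sq` — `L⁻² log Re Z_β(hubbardTorusTT' L t t' U − μN) → gcPressureTT' β t t' U μ`
  (along every `Ls → ∞`: `…_comp`);
* the certificate dictionary in the square-torus spelling: `gcPressureTT'_le_of_eventually_torus`,
  `le_gcPressureTT'_of_eventually_torus` (`β ≥ 0`, `U ≥ 0`, any real `μ`).

Everything is PROVED; no definition, no named fact.

## Mathlib / tree search

REUSED: `partitionFn_sub_smul_totalNumber_re_eq_sum`, `tendsto_torusGCPressureTT'`, `gcPressureTT'_le_of_eventually`,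
`le_gcPressureTT'_of_eventually` (`HubbardTTPrimeGrandCanonicalPressure`), `partitionFn_spinSector_hubbardTorusTT'_eq_rect`
(`TorusSectorGibbsOpenBoxBound`), `LiebTwoHoppings.preservesSectors_hamiltonian₂`, `card_rectSites`.
`lean search 'grandCanonical_hubbardTorusTT'`: nothing (2026-08-27).

## References

* D. Ruelle, *Statistical Mechanics: Rigorous Results* (1969), §3.4. [cite: Ruelle1969, §3.4]
* F. H. L. Essler et al., *The One-Dimensional Hubbard Model* (2005), §2.2.1 (lattice relabellings).
  [cite: EsslerEtAl2005, §2.2.1 eqs. (2.32)–(2.39)]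
-/

noncomputable section

namespace Literature.MathematicalPhysics.QuantumLattice

open Matrix Finset HubbardWave0 Literature.Probability.LatticeModels LiebThm1
open _root_.Filter
open scoped _root_.Topology ComplexOrder BigOperators

namespace ThermodynamicLimit

/-- **Square torus = rectangular torus for the grand-canonical partition function**:
`Re Z_β(hubbardTorusTT' L t t' U − μN) = Re Z_β(hubbardRectTorusTT' L L t t' U − μN)`.
[cite: EsslerEtAl2005, §2.2.1 eqs. (2.32)–(2.39)] -/
theorem partitionFn_grandCanonical_hubbardTorusTT'_re_eq_rect (L : ℕ) (t t' U β μ : ℝ) :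
    (partitionFn β (hubbardTorusTT' L t t' U - (μ : ℂ) • totalNumber)).re =
      (partitionFn β (hubbardRectTorusTT' L L t t' U - (μ : ℂ) • totalNumber)).re := by
  have hP₁ : PreservesSectors (hubbardTorusTT' L t t' U) := by
    unfold hubbardTorusTT'
    exact (preservesSectors_hamiltonian _ t U).add (preservesSectors_hamiltonian _ t' 0)
  have hP₂ : PreservesSectors (hubbardRectTorusTT' L L t t' U) := by
    unfold hubbardRectTorusTT'
    exact (preservesSectors_hamiltonian _ t U).add (preservesSectors_hamiltonian _ t' 0)
  have h₁ := partitionFn_sub_smul_totalNumber_re_eq_sum hP₁ β μ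
  have h₂ := partitionFn_sub_smul_totalNumber_re_eq_sum hP₂ β μ
  have hc₁ : Fintype.card (FermionTorus 2 L) = L * L := by simp [FermionTorus, sq]
  have hc₂ : Fintype.card (Fin L ×ₗ Fin L) = L * L := card_rectSites L L
  -- the two grand-canonical sides may carry different decidability instances on `totalNumber`'s scalar action;
  -- both equal the common sector sum
  have e₁ : (partitionFn β (hubbardTorusTT' L t t' U - (μ : ℂ) • totalNumber)).re =
      ∑ a ∈ Finset.range (L * L + 1), ∑ b ∈ Finset.range (L * L + 1),
        Real.exp (β * μ * (a + b)) * (partitionFn β (spinSectorHamiltonian a b (hubbardRectTorusTT' L L t t' U))).re := by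
    calc (partitionFn β (hubbardTorusTT' L t t' U - (μ : ℂ) • totalNumber)).re
        = ∑ a ∈ Finset.range (Fintype.card (FermionTorus 2 L) + 1),
            ∑ b ∈ Finset.range (Fintype.card (FermionTorus 2 L) + 1),
              Real.exp (β * μ * (a + b)) * (partitionFn β (spinSectorHamiltonian a b (hubbardTorusTT' L t t' U))).re := by
          convert h₁ using 4
      _ = _ := by
          rw [hc₁]
          refine Finset.sum_congr rfl fun a _ => Finset.sum_congr rfl fun b _ => ?_
          rw [partitionFn_spinSector_hubbardTorusTT'_eq_rect]
  have e₂ : (partitionFn β (hubbardRectTorusTT' L L t t' U - (μ : ℂ) • totalNumber)).re =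
      ∑ a ∈ Finset.range (L * L + 1), ∑ b ∈ Finset.range (L * L + 1),
        Real.exp (β * μ * (a + b)) * (partitionFn β (spinSectorHamiltonian a b (hubbardRectTorusTT' L L t t' U))).re := by
    calc (partitionFn β (hubbardRectTorusTT' L L t t' U - (μ : ℂ) • totalNumber)).re
        = ∑ a ∈ Finset.range (Fintype.card (Fin L ×ₗ Fin L) + 1),
            ∑ b ∈ Finset.range (Fintype.card (Fin L ×ₗ Fin L) + 1),
              Real.exp (β * μ * (a + b)) * (partitionFn β (spinSectorHamiltonian a b (hubbardRectTorusTT' L L t t' U))).re := by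
          convert h₂ using 4
      _ = _ := by rw [hc₂]
  rw [e₁, e₂]

section Dictionary

variable {β : ℝ} (hβ : 0 ≤ β) (t t' : ℝ) {U : ℝ} (hU : 0 ≤ U) (μ : ℝ)
include hβ hU

/-- **The grand-canonical pressure along the square tori**:
`L⁻² log Re Z_β(hubbardTorusTT' L t t' U − μN) → gcPressureTT' β t t' U μ`. [cite: Ruelle1969, §3.4] -/
theorem tendsto_log_partitionFn_grandCanonical_hubbardTorusTT'_div_sq :
    Tendsto (fun L : ℕ => Real.log (partitionFn β (hubbardTorusTT' L t t' U - (μ : ℂ) • totalNumber)).re /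
      (L : ℝ) ^ 2) atTop (𝓝 (gcPressureTT' β t t' U μ)) := by
  refine (tendsto_torusGCPressureTT' hβ t t' hU μ).congr fun L => ?_
  rw [torusGCPressureTT', partitionFn_grandCanonical_hubbardTorusTT'_re_eq_rect]

/-- The same along every side sequence `Ls → ∞`. [cite: Ruelle1969, §3.4] -/
theorem tendsto_log_partitionFn_grandCanonical_hubbardTorusTT'_div_sq_comp {Ls : ℕ → ℕ}
    (hLs : Tendsto Ls atTop atTop) :
    Tendsto (fun j : ℕ => Real.log (partitionFn β (hubbardTorusTT' (Ls j) t t' U - (μ : ℂ) • totalNumber)).re /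
      ((Ls j : ℕ) : ℝ) ^ 2) atTop (𝓝 (gcPressureTT' β t t' U μ)) :=
  (tendsto_log_partitionFn_grandCanonical_hubbardTorusTT'_div_sq hβ t t' hU μ).comp hLs

/-- **Grand-canonical CEILINGS on the square torus bound the number**: if along some `Ls → ∞`, for every `ε > 0`
eventually `log Re Z_β(hubbardTorusTT' L t t' U − μN) ≤ (q + ε) L²`, then `gcPressureTT' β t t' U μ ≤ q` (hence
`pressureTT' β t t' U n + βμn ≤ q` for every density, `pressureTT'_add_le_gcPressureTT'`). [cite: Ruelle1969, §3.4] -/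
theorem gcPressureTT'_le_of_eventually_torus {Ls : ℕ → ℕ} (hLs : Tendsto Ls atTop atTop) {q : ℝ}
    (hq : ∀ ε : ℝ, 0 < ε → ∀ᶠ j in atTop,
      Real.log (partitionFn β (hubbardTorusTT' (Ls j) t t' U - (μ : ℂ) • totalNumber)).re ≤
        (q + ε) * ((Ls j : ℕ) : ℝ) ^ 2) :
    gcPressureTT' β t t' U μ ≤ q := by
  refine gcPressureTT'_le_of_eventually hβ t t' hU μ hLs fun ε hε => ?_
  filter_upwards [hq ε hε] with j hj
  rwa [← partitionFn_grandCanonical_hubbardTorusTT'_re_eq_rect]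

/-- **Grand-canonical FLOORS on the square torus bound the number**: if along some `Ls → ∞`, for every `ε > 0`
eventually `(W − ε) L² ≤ log Re Z_β(hubbardTorusTT' L t t' U − μN)`, then `W ≤ gcPressureTT' β t t' U μ`.
[cite: Ruelle1969, §3.4] -/
theorem le_gcPressureTT'_of_eventually_torus {Ls : ℕ → ℕ} (hLs : Tendsto Ls atTop atTop) {W : ℝ}
    (hW : ∀ ε : ℝ, 0 < ε → ∀ᶠ j in atTop,
      (W - ε) * ((Ls j : ℕ) : ℝ) ^ 2 ≤
        Real.log (partitionFn β (hubbardTorusTT' (Ls j) t t' U - (μ : ℂ) • totalNumber)).re) :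
    W ≤ gcPressureTT' β t t' U μ := by
  refine le_gcPressureTT'_of_eventually hβ t t' hU μ hLs fun ε hε => ?_
  filter_upwards [hW ε hε] with j hj
  rwa [← partitionFn_grandCanonical_hubbardTorusTT'_re_eq_rect]

end Dictionary

end ThermodynamicLimit

end Literature.MathematicalPhysics.QuantumLattice
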